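import Literature.MathematicalPhysics.QuantumManyBody.OneBodyCurrentGain
import Literature.MathematicalPhysics.QuantumManyBody.PeriodicBoseGasImpurityTranslation
import Mathlib.Analysis.SpecialFunctions.Trigonometric.Deriv
import HarnessLib

/-!
# The Ward chord (f-sum rule in chord form) for the periodic Bose gas

Route `BECThomsonPrinciple`, crux `GaussianDominationCan` (stmt-AtomisticToContinuum-9479), line
`ward-chord-splitting` (second lead), stub S1 of the skeleton `Cruxes/GaussianDominationCan/Lines/ward-chord-splitting.lean`
— landed here as a stand-alone, definition-free theorem so that every prover of the route can use it verbatim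
(it is the KLS second-variation bound `c_k` of `GDTransfer`, and the current half of the charge of `FibreConductance`).

**Statement** (`wardChord`). For every pair potential `v : ℝ → ℝ≥0∞` (hard cores included), every particle number `N`,
side `L`, lattice mode `n : ℤ³`, phase `θ`, every `s ≥ 0` and every periodic Bose trial state `Φ`:

  `E₀^per(v, N, L) + s · |2 Im W_θ(Φ)| ≤ E_v(Φ) + s² · N |k|²`,

where `k = (2π/L) n`, `|k|² = (2π/L)² ∑ⱼ nⱼ²`, and
`W_θ(Φ) = ∑ᵢ ∫_{[0,L)^{3N}} cos(k·xᵢ + θ) · conj Φ(X) · (k·∇ᵢΦ)(X) dX` is the phased current–density integral, whose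
imaginary part `Im W_θ(Φ) = ∫ ∇f · j_Φ` (`f = sin(k·x + θ)`) is the longitudinal CURRENT paired with `∇f`.
Equivalently (square form) `|2 Im W_θ(Φ)|² ≤ 4 N|k|² (E_v(Φ) − E₀)`: Gaussian domination for every current source with
the FREE (f-sum) constant, uniformly in everything, with no window and no density condition.

**Proof.** The gauge family `Φ_t = e^{-it∑ⱼ f(xⱼ)}Φ` stays in the trial class (`PeriodicTrialState.phaseMul`), leaves
the interaction untouched, and `T(Φ_t) = T(Φ) − GAIN(tf; Φ)` with
`GAIN(tf; Φ) = 2t ∫∇f·j_Φ − t² ∫|∇f|² n_Φ` exactly (tree: `periodicForm_phaseMul`, `phaseGain`,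
`integral_sum_fderiv_mul_particleCurrent`, `integral_sum_fderiv_sq_mul_norm_sq`); since `|∇f|² ≤ |k|²` and `∫ n_Φ = N`,
`E₀ ≤ E(Φ_t) ≤ E(Φ) − 2t Im W_θ(Φ) + t² N|k|²`, and `t = ±s` gives the chord.  The linear phase `k·x` is handled as
an arbitrary continuous linear functional `κ : ℝ³ →L[ℝ] ℝ` with `κ(L eₗ) ∈ 2πℤ` (section `Gauge`, theorem
`wardChord_clm`), then specialised to `κ = (2π/L) ∑ⱼ nⱼ πⱼ`.

References: the f-sum rule / longitudinal current sum rule (Pines–Nozières, *The Theory of Quantum Liquids* I §2.4,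
II §4; Griffin, *Excitations in a Bose-condensed liquid* §6.1); gauge transformation of the kinetic form
[LSSY2005 §5.2 (5.19)–(5.23)]; B. Simon, Phys. Rev. Lett. 36 (1976) 1083 (universal diamagnetism, the operator-level
cousin).  All statements below are [folklore]-level.
-/

noncomputable section

namespace Summit.AtomisticToContinuum.BoseEinsteinCondensation.Cruxes.GaussianDominationCan.WardChordSplitting

open MeasureTheory
open scoped ENNReal ComplexConjugate
open Literature.MathematicalPhysics.QuantumManyBody.BoseGas

variable {N : ℕ} {L : ℝ}

/-! ### The gauge function `t sin(κ x + θ)` of a linear phase `κ` -/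

section Gauge

variable (κ : Space →L[ℝ] ℝ) (θ t : ℝ)

/-- `x ↦ t sin(κ x + θ)` is `C¹`. [folklore] -/
theorem contDiff_gauge : ContDiff ℝ 1 fun y : Space => t * Real.sin (κ y + θ) :=
  contDiff_const.mul (Real.contDiff_sin.comp (κ.contDiff.add contDiff_const))

/-- `d(t sin(κ x + θ)) = t cos(κ x + θ) · κ`. [folklore] -/
theorem hasFDerivAt_gauge (x : Space) :
    HasFDerivAt (fun y : Space => t * Real.sin (κ y + θ)) ((t * Real.cos (κ x + θ)) • κ) x := by
  have h1 : HasFDerivAt (fun y : Space => κ y + θ) κ x := κ.hasFDerivAt.add_const θ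
  have h2 := (Real.hasDerivAt_sin (κ x + θ)).comp_hasFDerivAt x h1
  have h3 := h2.const_mul t
  rw [smul_smul] at h3
  exact h3

/-- `∂ₗ (t sin(κ x + θ)) = t cos(κ x + θ) κ(eₗ)`. [folklore] -/
theorem fderiv_gauge_single (x : Space) (l : Fin 3) :
    fderiv ℝ (fun y : Space => t * Real.sin (κ y + θ)) x (EuclideanSpace.single l (1 : ℝ)) =
      t * Real.cos (κ x + θ) * κ (EuclideanSpace.single l (1 : ℝ)) := by
  rw [(hasFDerivAt_gauge κ θ t x).fderiv, _root_.smul_apply, smul_eq_mul]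

/-- Periodicity: if `κ(L eₗ) = 2π m` for an integer `m`, then `t sin(κ(x + L eₗ) + θ) = t sin(κ x + θ)`. [folklore] -/
theorem gauge_periodic {κ : Space →L[ℝ] ℝ} {l : Fin 3} {m : ℤ}
    (hκ : κ (EuclideanSpace.single l L) = 2 * Real.pi * m) (θ t : ℝ) (x : Space) :
    t * Real.sin (κ (x + EuclideanSpace.single l L) + θ) = t * Real.sin (κ x + θ) := by
  rw [map_add, hκ, show κ x + 2 * Real.pi * (m : ℝ) + θ = κ x + θ + (m : ℤ) * (2 * Real.pi) by ring,
    Real.sin_add_int_mul_two_pi]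

/-! ### Direction linearity: `∑ₗ kₗ ∂_{i,l} g = (k·∇ᵢ) g` -/

/-- `k = ∑ₗ kₗ eₗ` in `ℝ³`. [folklore] -/
theorem eq_sum_smul_single (k : Space) :
    k = ∑ l : Fin 3, (k l) • EuclideanSpace.single l (1 : ℝ) := by
  ext j
  simp [Finset.sum_apply, Pi.single_apply]

/-- `Pi.single i` is additive over a finite sum of vectors. [folklore] -/
theorem pi_single_sum (i : Fin N) (w : Fin 3 → Space) :
    (Pi.single i (∑ l, w l) : Config N) = ∑ l, (Pi.single i (w l) : Config N) := by
  have h := map_sum (AddMonoidHom.single (fun _ : Fin N => Space) i) w Finset.univ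
  simpa only [AddMonoidHom.single_apply] using h

/-- `∑ₗ kₗ · ∂_{i,l} g(X) = dg(X)(Pi.single i k)` (linearity of the Fréchet derivative in the direction). [folklore] -/
theorem sum_mul_fderiv_single (k : Space) (g : Config N → ℂ) (X : Config N) (i : Fin N) :
    ∑ l : Fin 3, (k l : ℂ) * fderiv ℝ g X (Pi.single i (EuclideanSpace.single l (1 : ℝ))) =
      fderiv ℝ g X (Pi.single i k) := by
  conv_rhs => rw [eq_sum_smul_single k, pi_single_sum]
  rw [map_sum]
  refine Finset.sum_congr rfl fun l _ => ?_
  rw [Pi.single_smul' i (k l) (EuclideanSpace.single l (1 : ℝ)), ContinuousLinearMap.map_smul,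
    Complex.real_smul]

/-! ### The two integrands of the gain for the gauge function -/

/-- Current integrand: with `κ(eₗ) = kₗ`,
`∑ₗ ∂ₗ(t sin(κ·+θ))(xᵢ) · J_{i,l}(X) = t · cos(κ xᵢ + θ) · Im(conj Φ(X) · dΦ(X)(Pi.single i k))`. [folklore] -/
theorem current_integrand_eq {κ : Space →L[ℝ] ℝ} {k : Space}
    (hk : ∀ l : Fin 3, κ (EuclideanSpace.single l (1 : ℝ)) = k l) (θ t : ℝ) (ψ : Config N → ℂ)
    (X : Config N) (i : Fin N) :
    ∑ l : Fin 3, fderiv ℝ (fun y : Space => t * Real.sin (κ y + θ)) (X i) (EuclideanSpace.single l 1) *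
        particleCurrent i l ψ X =
      t * (Real.cos (κ (X i) + θ) * ((starRingEnd ℂ) (ψ X) * fderiv ℝ ψ X (Pi.single i k)).im) := by
  rw [← sum_mul_fderiv_single, Finset.mul_sum, Complex.im_sum, Finset.mul_sum, Finset.mul_sum]
  refine Finset.sum_congr rfl fun l _ => ?_
  rw [fderiv_gauge_single, hk, particleCurrent]
  have : (starRingEnd ℂ) (ψ X) * ((k l : ℂ) * fderiv ℝ ψ X (Pi.single i (EuclideanSpace.single l 1)))
      = (k l : ℂ) * ((starRingEnd ℂ) (ψ X) * fderiv ℝ ψ X (Pi.single i (EuclideanSpace.single l 1))) := by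
    ring
  rw [this, Complex.im_ofReal_mul]
  ring

/-- Density integrand: with `κ(eₗ) = kₗ`,
`∑ᵢ ∑ₗ (∂ₗ(t sin(κ·+θ))(xᵢ))² ‖Φ(X)‖² ≤ N · t² (∑ₗ kₗ²) ‖Φ(X)‖²` (`cos² ≤ 1`). [folklore] -/
theorem density_integrand_le {κ : Space →L[ℝ] ℝ} {k : Space}
    (hk : ∀ l : Fin 3, κ (EuclideanSpace.single l (1 : ℝ)) = k l) (θ t : ℝ) (ψ : Config N → ℂ)
    (X : Config N) :
    ∑ i : Fin N, ∑ l : Fin 3,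
        fderiv ℝ (fun y : Space => t * Real.sin (κ y + θ)) (X i) (EuclideanSpace.single l 1) ^ 2 * ‖ψ X‖ ^ 2 ≤
      (N : ℝ) * (t ^ 2 * (∑ l : Fin 3, k l ^ 2) * ‖ψ X‖ ^ 2) := by
  have hK : 0 ≤ ∑ l : Fin 3, k l ^ 2 := Finset.sum_nonneg fun l _ => sq_nonneg _
  have hi : ∀ i : Fin N, ∑ l : Fin 3,
      fderiv ℝ (fun y : Space => t * Real.sin (κ y + θ)) (X i) (EuclideanSpace.single l 1) ^ 2 * ‖ψ X‖ ^ 2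
        ≤ t ^ 2 * (∑ l : Fin 3, k l ^ 2) * ‖ψ X‖ ^ 2 := by
    intro i
    have heq : ∑ l : Fin 3,
        fderiv ℝ (fun y : Space => t * Real.sin (κ y + θ)) (X i) (EuclideanSpace.single l 1) ^ 2 * ‖ψ X‖ ^ 2
          = t ^ 2 * Real.cos (κ (X i) + θ) ^ 2 * (∑ l : Fin 3, k l ^ 2) * ‖ψ X‖ ^ 2 := by
      simp_rw [fderiv_gauge_single, hk]
      rw [Finset.mul_sum, Finset.sum_mul]
      refine Finset.sum_congr rfl fun l _ => ?_
      ring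
    rw [heq]
    have hcos : Real.cos (κ (X i) + θ) ^ 2 ≤ 1 := by
      rw [sq_le_one_iff_abs_le_one]; exact Real.abs_cos_le_one _
    have h0 : 0 ≤ t ^ 2 * (∑ l : Fin 3, k l ^ 2) * ‖ψ X‖ ^ 2 := by positivity
    calc t ^ 2 * Real.cos (κ (X i) + θ) ^ 2 * (∑ l : Fin 3, k l ^ 2) * ‖ψ X‖ ^ 2
        = Real.cos (κ (X i) + θ) ^ 2 * (t ^ 2 * (∑ l : Fin 3, k l ^ 2) * ‖ψ X‖ ^ 2) := by ring
      _ ≤ 1 * (t ^ 2 * (∑ l : Fin 3, k l ^ 2) * ‖ψ X‖ ^ 2) := mul_le_mul_of_nonneg_right hcos h0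
      _ = t ^ 2 * (∑ l : Fin 3, k l ^ 2) * ‖ψ X‖ ^ 2 := one_mul _
  calc ∑ i : Fin N, ∑ l : Fin 3,
        fderiv ℝ (fun y : Space => t * Real.sin (κ y + θ)) (X i) (EuclideanSpace.single l 1) ^ 2 * ‖ψ X‖ ^ 2
      ≤ ∑ _i : Fin N, t ^ 2 * (∑ l : Fin 3, k l ^ 2) * ‖ψ X‖ ^ 2 := Finset.sum_le_sum fun i _ => hi i
    _ = (N : ℝ) * (t ^ 2 * (∑ l : Fin 3, k l ^ 2) * ‖ψ X‖ ^ 2) := by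
        rw [Finset.sum_const, Finset.card_univ, Fintype.card_fin, nsmul_eq_mul]

end Gauge

/-! ### Integrability and `∫ ‖Φ‖² = 1` -/

/-- `∫_{cell^N} ‖Φ‖² = 1` as a real (Bochner) integral. [folklore] -/
theorem integral_norm_sq_eq_one (Φ : PeriodicTrialState N L) :
    ∫ X in cellN N L, ‖Φ.ψ X‖ ^ 2 = 1 := by
  have hint : Integrable (fun X => ‖Φ.ψ X‖ ^ 2) (volume.restrict (cellN N L)) :=
    integrableOn_cellN ((Φ.contDiff.continuous.norm).pow 2) L
  have h := ofReal_integral_eq_lintegral_ofReal hint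
    (Filter.Eventually.of_forall fun X => sq_nonneg _)
  simp_rw [← coe_nnnorm_sq_eq_ofReal] at h
  rw [Φ.norm_eq] at h
  have hnn : 0 ≤ ∫ X in cellN N L, ‖Φ.ψ X‖ ^ 2 := integral_nonneg fun X => sq_nonneg _
  have := congrArg ENNReal.toReal h
  rwa [ENNReal.toReal_ofReal hnn, ENNReal.toReal_one] at this

/-- The phased current integrand `cos(κ xᵢ + θ) · conj Φ · dΦ(Pi.single i k)` is continuous for `Φ ∈ C¹`. [folklore] -/
theorem continuous_phasedIntegrand (κ : Space →L[ℝ] ℝ) (k : Space) (θ : ℝ) (i : Fin N) {ψ : Config N → ℂ}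
    (hψ : ContDiff ℝ 1 ψ) :
    Continuous fun X : Config N =>
      (Real.cos (κ (X i) + θ) : ℂ) * ((starRingEnd ℂ) (ψ X) * fderiv ℝ ψ X (Pi.single i k)) := by
  refine (Complex.continuous_ofReal.comp (Real.continuous_cos.comp
    ((κ.continuous.comp (continuous_apply i)).add continuous_const))).mul ?_
  exact (Complex.continuous_conj.comp hψ.continuous).mul
    ((hψ.continuous_fderiv one_ne_zero).clm_apply continuous_const)

/-- `Im W_θ(Φ) = ∑ᵢ ∫ cos(κ xᵢ + θ) Im(conj Φ · dΦ(Pi.single i k))` (the imaginary part passes inside). [folklore] -/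
theorem im_phasedCurrent (κ : Space →L[ℝ] ℝ) (k : Space) (θ : ℝ) (Φ : PeriodicTrialState N L) :
    (∑ i : Fin N, ∫ X in cellN N L,
        (Real.cos (κ (X i) + θ) : ℂ) * ((starRingEnd ℂ) (Φ.ψ X) * fderiv ℝ Φ.ψ X (Pi.single i k))).im =
      ∑ i : Fin N, ∫ X in cellN N L,
        Real.cos (κ (X i) + θ) * ((starRingEnd ℂ) (Φ.ψ X) * fderiv ℝ Φ.ψ X (Pi.single i k)).im := by
  rw [Complex.im_sum]
  refine Finset.sum_congr rfl fun i _ => ?_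
  have hint : Integrable (fun X : Config N =>
      (Real.cos (κ (X i) + θ) : ℂ) * ((starRingEnd ℂ) (Φ.ψ X) * fderiv ℝ Φ.ψ X (Pi.single i k)))
      (volume.restrict (cellN N L)) :=
    integrableOn_cellN (continuous_phasedIntegrand κ k θ i Φ.contDiff) L
  have h := integral_im hint
  simp only [RCLike.im_to_complex] at h
  rw [← h]
  refine integral_congr_ae (Filter.Eventually.of_forall fun X => ?_)
  simp only [Complex.im_ofReal_mul]

/-! ### The gain of the gauge function and the Ward chord for a linear phase -/

/-- `GAIN(t sin(κ·+θ); Φ) = 2t · Im W_θ(Φ) − B` with `B ≤ t² N ∑ₗ kₗ²` (for `κ(eₗ) = kₗ`). [folklore] -/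
theorem phaseGain_gauge {κ : Space →L[ℝ] ℝ} {k : Space} (hk : ∀ l : Fin 3, κ (EuclideanSpace.single l (1 : ℝ)) = k l)
    (θ t : ℝ) (Φ : PeriodicTrialState N L) :
    ∃ B : ℝ, B ≤ t ^ 2 * ((N : ℝ) * ∑ l : Fin 3, k l ^ 2) ∧
      phaseGain L N Φ.ψ (fun y : Space => t * Real.sin (κ y + θ)) =
        2 * (t * (∑ i : Fin N, ∫ X in cellN N L, (Real.cos (κ (X i) + θ) : ℂ) *
          ((starRingEnd ℂ) (Φ.ψ X) * fderiv ℝ Φ.ψ X (Pi.single i k))).im) - B := by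
  have hg : ContDiff ℝ 1 (fun y : Space => t * Real.sin (κ y + θ)) := contDiff_gauge κ θ t
  refine ⟨∫ X in cellN N L, ∑ i : Fin N, ∑ l : Fin 3,
      fderiv ℝ (fun y : Space => t * Real.sin (κ y + θ)) (X i) (EuclideanSpace.single l 1) ^ 2 * ‖Φ.ψ X‖ ^ 2,
    ?_, ?_⟩
  · -- `B ≤ t² N ∑ kₗ²`
    have hcont : Continuous fun X : Config N => ∑ i : Fin N, ∑ l : Fin 3,
        fderiv ℝ (fun y : Space => t * Real.sin (κ y + θ)) (X i) (EuclideanSpace.single l 1) ^ 2 *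
          ‖Φ.ψ X‖ ^ 2 :=
      continuous_finsetSum _ fun i _ => continuous_finsetSum _ fun l _ =>
        (((continuous_fderiv_apply_single hg l).comp (continuous_apply i)).pow 2).mul
          ((Φ.contDiff.continuous.norm).pow 2)
    have h1 : ∫ X in cellN N L, ∑ i : Fin N, ∑ l : Fin 3,
        fderiv ℝ (fun y : Space => t * Real.sin (κ y + θ)) (X i) (EuclideanSpace.single l 1) ^ 2 *
          ‖Φ.ψ X‖ ^ 2 ≤
        ∫ X in cellN N L, (N : ℝ) * (t ^ 2 * (∑ l : Fin 3, k l ^ 2) * ‖Φ.ψ X‖ ^ 2) := by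
      refine integral_mono (integrableOn_cellN hcont L) ?_ fun X => density_integrand_le hk θ t Φ.ψ X
      exact integrableOn_cellN (continuous_const.mul (continuous_const.mul
        ((Φ.contDiff.continuous.norm).pow 2))) L
    have h2 : ∫ X in cellN N L, (N : ℝ) * (t ^ 2 * (∑ l : Fin 3, k l ^ 2) * ‖Φ.ψ X‖ ^ 2) =
        t ^ 2 * ((N : ℝ) * ∑ l : Fin 3, k l ^ 2) := by
      have : (fun X => (N : ℝ) * (t ^ 2 * (∑ l : Fin 3, k l ^ 2) * ‖Φ.ψ X‖ ^ 2)) =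
          fun X => ((N : ℝ) * (t ^ 2 * ∑ l : Fin 3, k l ^ 2)) * ‖Φ.ψ X‖ ^ 2 := by funext X; ring
      rw [this, integral_const_mul, integral_norm_sq_eq_one, mul_one]; ring
    linarith
  · -- the gain
    unfold phaseGain
    rw [← integral_sum_fderiv_mul_particleCurrent hg Φ.contDiff,
      ← integral_sum_fderiv_sq_mul_norm_sq hg Φ.contDiff]
    congr 1
    have hW := im_phasedCurrent κ k θ Φ
    simp_rw [current_integrand_eq hk]
    rw [hW, Finset.mul_sum]
    congr 1
    rw [integral_finsetSum]
    · refine Finset.sum_congr rfl fun i _ => ?_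
      exact integral_const_mul _ _
    · intro i _
      refine (integrableOn_cellN ?_ L)
      refine continuous_const.mul ((Real.continuous_cos.comp
        ((κ.continuous.comp (continuous_apply i)).add continuous_const)).mul ?_)
      exact Complex.continuous_im.comp ((Complex.continuous_conj.comp Φ.contDiff.continuous).mul
        ((Φ.contDiff.continuous_fderiv one_ne_zero).clm_apply continuous_const))

/-- **The Ward chord for a linear phase.** Let `κ : ℝ³ →L[ℝ] ℝ` with `κ(eₗ) = kₗ` and `κ(L eₗ) ∈ 2πℤ` for every axis
`l`. Then for every `v`, every `s ≥ 0` and every periodic trial state `Φ` of `N` bosons on the torus of side `L`: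
`E₀^per + s|2 Im W_θ(Φ)| ≤ E_v(Φ) + s² N ∑ₗ kₗ²`, `W_θ(Φ) = ∑ᵢ∫ cos(κ xᵢ + θ) conj Φ · dΦ(Pi.single i k)`. [folklore] -/
theorem wardChord_clm (v : ℝ → ℝ≥0∞) {κ : Space →L[ℝ] ℝ} {k : Space}
    (hk : ∀ l : Fin 3, κ (EuclideanSpace.single l (1 : ℝ)) = k l)
    (hper : ∀ l : Fin 3, ∃ m : ℤ, κ (EuclideanSpace.single l L) = 2 * Real.pi * m)
    (θ s : ℝ) (hs : 0 ≤ s) (Φ : PeriodicTrialState N L) :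
    periodicGroundStateEnergy v N L +
        ENNReal.ofReal (s * |2 * (∑ i : Fin N, ∫ X in cellN N L, (Real.cos (κ (X i) + θ) : ℂ) *
          ((starRingEnd ℂ) (Φ.ψ X) * fderiv ℝ Φ.ψ X (Pi.single i k))).im|) ≤
      periodicEnergy v Φ + ENNReal.ofReal (s ^ 2 * ((N : ℝ) * ∑ l : Fin 3, k l ^ 2)) := by
  by_cases hE : periodicEnergy v Φ = ⊤
  · rw [hE, top_add]; exact le_top
  -- the sign of the gauge amplitude
  set W := ∑ i : Fin N, ∫ X in cellN N L, (Real.cos (κ (X i) + θ) : ℂ) *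
    ((starRingEnd ℂ) (Φ.ψ X) * fderiv ℝ Φ.ψ X (Pi.single i k)) with hW
  set t : ℝ := if 0 ≤ W.im then s else -s with ht
  have ht2 : t ^ 2 = s ^ 2 := by rw [ht]; split_ifs <;> ring
  have htW : t * W.im = s * |W.im| := by
    rw [ht]; split_ifs with h
    · rw [abs_of_nonneg h]
    · rw [abs_of_neg (not_le.mp h)]; ring
  -- the gauge-transformed trial state
  have hgc : ContDiff ℝ 1 (fun y : Space => t * Real.sin (κ y + θ)) := contDiff_gauge κ θ t
  have hgp : ∀ (x : Space) (l : Fin 3), (fun y : Space => t * Real.sin (κ y + θ)) (x + EuclideanSpace.single l L) =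
      (fun y : Space => t * Real.sin (κ y + θ)) x := fun x l => by
    obtain ⟨m, hm⟩ := hper l
    exact gauge_periodic hm θ t x
  have hvar : periodicGroundStateEnergy v N L ≤ periodicEnergy v (Φ.phaseMul hgc hgp) :=
    periodicGroundStateEnergy_le v _
  -- energies through the gain identity
  set T := cellKineticEnergy L Φ.ψ with hT
  set V := ∫⁻ X in cellN N L, periodicInteraction v L X * (‖Φ.ψ X‖₊ : ℝ≥0∞) ^ 2 with hV
  have hEΨ : periodicEnergy v (Φ.phaseMul hgc hgp) =
      ENNReal.ofReal (T - phaseGain L N Φ.ψ (fun y : Space => t * Real.sin (κ y + θ))) + V := by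
    rw [periodicEnergy_eq_periodicForm, PeriodicTrialState.phaseMul_ψ]
    exact periodicForm_phaseMul v hgc Φ.contDiff L
  have hEΦ : periodicEnergy v Φ = ENNReal.ofReal T + V := by
    have h := periodicForm_phaseMul v (contDiff_const (c := (0 : ℝ))) Φ.contDiff L
    rw [phaseMul_zero, phaseGain_const, sub_zero] at h
    rw [periodicEnergy_eq_periodicForm]
    exact h
  obtain ⟨B, hB, hgain⟩ := phaseGain_gauge hk θ t Φ
  rw [← hW] at hgain
  -- `T - GAIN ≥ 0` (it is a kinetic energy)
  have hTG : 0 ≤ T - phaseGain L N Φ.ψ (fun y : Space => t * Real.sin (κ y + θ)) := by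
    rw [hT, ← cellKineticEnergy_phaseMul hgc Φ.contDiff L]
    exact cellKineticEnergy_nonneg L _
  have hT0 : 0 ≤ T := cellKineticEnergy_nonneg L _
  have hsW : 0 ≤ s * |2 * W.im| := mul_nonneg hs (abs_nonneg _)
  have hK : 0 ≤ ∑ l : Fin 3, k l ^ 2 := Finset.sum_nonneg fun l _ => sq_nonneg _
  have hk0 : 0 ≤ s ^ 2 * ((N : ℝ) * ∑ l : Fin 3, k l ^ 2) := by positivity
  -- assemble
  rw [hEΨ] at hvar
  rw [hEΦ]
  calc periodicGroundStateEnergy v N L + ENNReal.ofReal (s * |2 * W.im|)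
      ≤ ENNReal.ofReal (T - phaseGain L N Φ.ψ (fun y : Space => t * Real.sin (κ y + θ))) + V +
          ENNReal.ofReal (s * |2 * W.im|) := add_le_add hvar le_rfl
    _ = ENNReal.ofReal (T - phaseGain L N Φ.ψ (fun y : Space => t * Real.sin (κ y + θ)) + s * |2 * W.im|) +
          V := by
        rw [ENNReal.ofReal_add hTG hsW]; ring
    _ ≤ ENNReal.ofReal (T + s ^ 2 * ((N : ℝ) * ∑ l : Fin 3, k l ^ 2)) + V := by
        refine add_le_add (ENNReal.ofReal_le_ofReal ?_) le_rfl
        have hB' : B ≤ s ^ 2 * ((N : ℝ) * ∑ l : Fin 3, k l ^ 2) := by rw [← ht2]; exact hB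
        rw [hgain, abs_mul, abs_two]
        linarith [hB', htW]
    _ = ENNReal.ofReal T + V + ENNReal.ofReal (s ^ 2 * ((N : ℝ) * ∑ l : Fin 3, k l ^ 2)) := by
        rw [ENNReal.ofReal_add hT0 hk0]; ring

/-! ### The Ward chord for the lattice modes `k = (2π/L) n` -/

/-- The linear phase `x ↦ (2π/L) ∑ⱼ nⱼ xⱼ` as a continuous linear functional, evaluated. [folklore] -/
theorem modeCLM_apply (L : ℝ) (n : Fin 3 → ℤ) (x : Space) :
    ((2 * Real.pi / L) • ∑ j : Fin 3, (n j : ℝ) • PiLp.proj 2 (fun _ : Fin 3 => ℝ) j : Space →L[ℝ] ℝ) x =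
      2 * Real.pi / L * ∑ j, (n j : ℝ) * x j := by
  simp only [_root_.smul_apply, _root_.sum_apply, PiLp.proj_apply, smul_eq_mul]

/-- … on a unit vector: `κ(eₗ) = (2π/L) nₗ`. [folklore] -/
theorem modeCLM_single (L : ℝ) (n : Fin 3 → ℤ) (l : Fin 3) :
    ((2 * Real.pi / L) • ∑ j : Fin 3, (n j : ℝ) • PiLp.proj 2 (fun _ : Fin 3 => ℝ) j : Space →L[ℝ] ℝ)
        (EuclideanSpace.single l (1 : ℝ)) =
      (WithLp.toLp 2 fun j => 2 * Real.pi / L * (n j : ℝ) : Space) l := by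
  rw [modeCLM_apply]
  simp [Finset.sum_ite_eq']

/-- … on a period: `κ(L eₗ) = 2π nₗ` for `L ≠ 0`. [folklore] -/
theorem modeCLM_single_side {L : ℝ} (hL : L ≠ 0) (n : Fin 3 → ℤ) (l : Fin 3) :
    ((2 * Real.pi / L) • ∑ j : Fin 3, (n j : ℝ) • PiLp.proj 2 (fun _ : Fin 3 => ℝ) j : Space →L[ℝ] ℝ)
        (EuclideanSpace.single l L) = 2 * Real.pi * (n l : ℤ) := by
  rw [modeCLM_apply]
  simp only [PiLp.single_apply, mul_ite, mul_zero, Finset.sum_ite_eq', Finset.mem_univ, if_true]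
  field_simp

/-- `∑ₗ kₗ² = (2π/L)² ∑ⱼ nⱼ²` for `k = (2π/L) n`. [folklore] -/
theorem sum_mode_sq (L : ℝ) (n : Fin 3 → ℤ) :
    ∑ l : Fin 3, (WithLp.toLp 2 fun j => 2 * Real.pi / L * (n j : ℝ) : Space) l ^ 2 =
      (2 * Real.pi / L) ^ 2 * ∑ j, (n j : ℝ) ^ 2 := by
  rw [Finset.mul_sum]
  refine Finset.sum_congr rfl fun l _ => ?_
  rw [PiLp.toLp_apply]
  ring

/-- **The Ward chord** (f-sum rule in chord form; stub S1 of line `ward-chord-splitting`, definition-free).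
For every pair potential `v`, every `N`, `L`, lattice mode `n : ℤ³`, phase `θ`, every `s ≥ 0` and every periodic Bose
trial state `Φ`, with `k = (2π/L) n`:
`E₀^per(v,N,L) + s·|2 Im ∑ᵢ∫ cos(k·xᵢ+θ) conj Φ (k·∇ᵢΦ)| ≤ E_v(Φ) + s²·N|k|²`, `|k|² = (2π/L)²∑ⱼnⱼ²` — i.e.
`|⟨J_f⟩_Φ|² ≤ 4N‖∇f‖²∞(E_v(Φ) − E₀)` for `f = sin(k·x+θ)`: Gaussian domination for the longitudinal current source with
the free constant, no window, no density condition, hard cores included (`E_v(Φ) = ⊤` is trivial). [folklore] -/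
theorem wardChord : ∀ (v : ℝ → ℝ≥0∞) (N : ℕ) (L : ℝ) (n : Fin 3 → ℤ) (θ s : ℝ), 0 ≤ s →
    ∀ Φ : PeriodicTrialState N L,
    periodicGroundStateEnergy v N L +
        ENNReal.ofReal (s * |2 * (∑ i : Fin N, ∫ X in cellN N L,
          (Real.cos (2 * Real.pi / L * (∑ j, (n j : ℝ) * X i j) + θ) : ℂ) *
            ((starRingEnd ℂ) (Φ.ψ X) *
              fderiv ℝ Φ.ψ X (Pi.single i (WithLp.toLp 2 fun j => 2 * Real.pi / L * (n j : ℝ))))).im|) ≤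
      periodicEnergy v Φ + ENNReal.ofReal (s ^ 2 * ((N : ℝ) * ((2 * Real.pi / L) ^ 2 * ∑ j, (n j : ℝ) ^ 2))) := by
  intro v N L n θ s hs Φ
  cases N with
  | zero =>
    simp only [Finset.univ_eq_empty, Finset.sum_empty, Complex.zero_im, mul_zero, abs_zero,
      ENNReal.ofReal_zero, add_zero]
    exact (periodicGroundStateEnergy_le v Φ).trans le_self_add
  | succ m =>
    have hL : 0 < L := Φ.side_pos
    have h := wardChord_clm (N := m + 1) v (κ := (2 * Real.pi / L) • ∑ j : Fin 3,
        (n j : ℝ) • PiLp.proj 2 (fun _ : Fin 3 => ℝ) j)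
      (k := (WithLp.toLp 2 fun j => 2 * Real.pi / L * (n j : ℝ) : Space))
      (fun l => modeCLM_single L n l) (fun l => ⟨n l, modeCLM_single_side hL.ne' n l⟩) θ s hs Φ
    simp only [modeCLM_apply, sum_mode_sq] at h
    exact h

end Summit.AtomisticToContinuum.BoseEinsteinCondensation.Cruxes.GaussianDominationCan.WardChordSplitting

end
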